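import Mathlib
import HarnessLib

/-!
# Smoothing coboundary III — the Mahler equation `η·G∘s − G = Φ` on `k⟦T⟧` has exactly one solution, determined to every
# `T`-adic precision (card (B)/(D) of `Ideas/smoothing-coboundary.md`: «`U_β = 1 + η(β)[β]*` is invertible on `𝔽̄₂⟦T⟧` for
# `[β] ≡ T`, `η(β) ≠ 1`»; «`G_χ` is the unique solution of `G + η(β)·G∘[β] = Φ_β`», «`G_χ∘[u] ≡ … (mod T^{4^k})`»)
# (seed crux `SignedMuSeedAtTwoPlus` stmt-BirchSwinnertonDyer-21438; parent Kμ⁺ stmt-BirchSwinnertonDyer-20689, route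
# ResidualThetaTransportAtTwo)

Cell `bsd-wall`, width seat `bsd-wall-rtt-p4-w2` g15 (`--supports`, closes nothing).  THEOREMS ONLY; BSD is not proved by this.

In the currency of the line's power-series files (`PowerSeries.subst` for `∘[β]`, as in `…TiltCoboundary`): for a commutative
ring `k`, a scalar `η` with `η − 1` a unit, and a substitution series `s = T + O(T²)` (`constantCoeff s = 0`, `coeff 1 s = 1` —
the card's `β ≡ 1 (mod 2𝒪_K)`, tangent scalar `β̃ = 1`), the twisted substitution operator `U G := η • G.subst s − G` is
TRIANGULAR in the coefficient basis with the unit `η − 1` on the diagonal: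

* `coeff_subst_X_mul`, `coeff_subst_X_mul_eq_add` — `[Tⁿ](G∘(T·t)) = Σ_{d≤n} g_d·[T^{n−d}] t^d`, top term `g_n·t(0)ⁿ`;
* `coeff_twistSubst` — `[Tⁿ](η·G∘(T·t) − G) = (η − 1)·g_n + η·Σ_{d<n} g_d·[T^{n−d}] t^d` when `t(0) = 1`;
* `coeff_eq_zero_of_coeff_twistSubst_eq_zero` — `U H ≡ 0 (mod Tᴺ) ⇒ H ≡ 0 (mod Tᴺ)`;
* **`mahler_unique`**, **`mahler_congr_mod`** — the solution of `U G = Φ` is unique, and determined modulo `Tᴺ` by `Φ mod Tᴺ`;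
* **`mahler_exists`**, **`mahler_existsUnique`** — a solution exists (coefficients by the triangular recursion), hence `∃! G`;
* `mahler_existsUnique_charTwo` — the card's form `G + η·G∘s = Φ` in characteristic `2`.

[folklore]
-/

set_option autoImplicit false
-- the Theorems namespace of this sub repeats the summit name by design (D-0017 nested layout)
set_option linter.dupNamespace false

noncomputable section

open PowerSeries Finset

namespace Summit.BirchSwinnertonDyer.BirchSwinnertonDyer.Theorems.SignedMuAtTwo.SmoothingCoboundary

variable {k : Type*} [CommRing k]

/-- Coefficients of a substitution `G∘(T·t)`: `[Tⁿ](G∘(T·t)) = Σ_{d ≤ n} g_d · [T^{n−d}](t^d)` (only `d ≤ n` contribute,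
because `(T·t)^d = T^d·t^d`). [folklore] -/
theorem coeff_subst_X_mul (t G : PowerSeries k) (n : ℕ) :
    coeff n (G.subst (X * t)) = ∑ d ∈ range (n + 1), coeff d G * coeff (n - d) (t ^ d) := by
  have hs : HasSubst (X * t : PowerSeries k) := HasSubst.of_constantCoeff_zero' (by simp)
  rw [coeff_subst' hs, finsum_eq_sum_of_support_subset _ (s := range (n + 1)) ?_]
  · refine sum_congr rfl fun d hd => ?_
    rw [mul_pow, coeff_X_pow_mul', if_pos (by simpa [Nat.lt_succ_iff] using hd), smul_eq_mul]
  · intro d hd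
    simp only [Function.mem_support, ne_eq] at hd
    simp only [coe_range, Set.mem_Iio, Nat.lt_succ_iff]
    by_contra h
    apply hd
    rw [mul_pow, coeff_X_pow_mul', if_neg h, smul_zero]

/-- The same with the top term split off: `[Tⁿ](G∘(T·t)) = Σ_{d<n} g_d·[T^{n−d}](t^d) + g_n·t(0)ⁿ`. [folklore] -/
theorem coeff_subst_X_mul_eq_add (t G : PowerSeries k) (n : ℕ) :
    coeff n (G.subst (X * t))
      = (∑ d ∈ range n, coeff d G * coeff (n - d) (t ^ d)) + coeff n G * constantCoeff t ^ n := by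
  rw [coeff_subst_X_mul, sum_range_succ, Nat.sub_self, coeff_zero_eq_constantCoeff_apply, map_pow]

/-- **Triangularity of the twisted substitution operator**: for `t(0) = 1` (i.e. `s = T·t ≡ T`),
`[Tⁿ](η·G∘(T·t) − G) = (η − 1)·g_n + η·Σ_{d<n} g_d·[T^{n−d}](t^d)`. [folklore] -/
theorem coeff_twistSubst (η : k) {t : PowerSeries k} (ht : constantCoeff t = 1) (G : PowerSeries k) (n : ℕ) :
    coeff n (η • G.subst (X * t) - G)
      = (η - 1) * coeff n G + η * ∑ d ∈ range n, coeff d G * coeff (n - d) (t ^ d) := by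
  rw [map_sub, map_smul, coeff_subst_X_mul_eq_add, ht, one_pow, mul_one, smul_eq_mul]
  ring

/-- **Injectivity modulo `Tᴺ`**: if `η − 1` is a unit, `t(0) = 1` and `η·H∘(T·t) − H ≡ 0 (mod Tᴺ)` then `H ≡ 0 (mod Tᴺ)`
(strong induction on the coefficient index). [folklore] -/
theorem coeff_eq_zero_of_coeff_twistSubst_eq_zero {η : k} (hη : IsUnit (η - 1)) {t : PowerSeries k}
    (ht : constantCoeff t = 1) {H : PowerSeries k} {N : ℕ}
    (h : ∀ n < N, coeff n (η • H.subst (X * t) - H) = 0) : ∀ n < N, coeff n H = 0 := by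
  intro n
  induction n using Nat.strong_induction_on with
  | _ n ih =>
    intro hn
    have hc := h n hn
    rw [coeff_twistSubst η ht H n, sum_eq_zero (fun d hd => ?_), mul_zero, add_zero] at hc
    · exact (hη.mul_right_eq_zero).mp hc
    · rw [ih d (mem_range.mp hd) (lt_trans (mem_range.mp hd) hn), zero_mul]

/-- A substitution series `s ≡ T (mod T²)` is `T·t` with `t(0) = 1`. [folklore] -/
theorem exists_eq_X_mul {s : PowerSeries k} (hs0 : constantCoeff s = 0) (hs1 : coeff 1 s = 1) :
    ∃ t : PowerSeries k, s = X * t ∧ constantCoeff t = 1 := by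
  obtain ⟨t, rfl⟩ := X_dvd_iff.mpr hs0
  refine ⟨t, rfl, ?_⟩
  rwa [coeff_succ_X_mul, coeff_zero_eq_constantCoeff_apply] at hs1

/-- The twisted substitution operator is additive in the shape used below:
`(η·G∘s − G) − (η·G'∘s − G') = η·(G − G')∘s − (G − G')`. [folklore] -/
theorem twistSubst_sub (η : k) {s : PowerSeries k} (hs0 : constantCoeff s = 0) (G G' : PowerSeries k) :
    (η • G.subst s - G) - (η • G'.subst s - G') = η • (G - G').subst s - (G - G') := by
  rw [subst_sub (HasSubst.of_constantCoeff_zero' hs0), smul_sub]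
  abel

/-- **The solution of the Mahler equation is determined modulo `Tᴺ` by the right-hand side modulo `Tᴺ`**
(card (D): «`G_χ∘[u] ≡ η(β)⁻¹(G_χ + Φ_β) (mod T^{4^k})`» is meaningful precision by precision). [folklore] -/
theorem mahler_congr_mod {η : k} (hη : IsUnit (η - 1)) {s : PowerSeries k} (hs0 : constantCoeff s = 0)
    (hs1 : coeff 1 s = 1) {G G' : PowerSeries k} {N : ℕ}
    (h : ∀ n < N, coeff n (η • G.subst s - G) = coeff n (η • G'.subst s - G')) :
    ∀ n < N, coeff n G = coeff n G' := by
  obtain ⟨t, rfl, ht⟩ := exists_eq_X_mul hs0 hs1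
  intro n hn
  rw [← sub_eq_zero, ← map_sub]
  refine coeff_eq_zero_of_coeff_twistSubst_eq_zero hη ht (fun m hm => ?_) n hn
  rw [← twistSubst_sub η hs0, map_sub, h m hm, sub_self]

/-- **Uniqueness for the Mahler equation** `η·G∘s − G = Φ` on `k⟦T⟧` (`η − 1` a unit, `s ≡ T (mod T²)`):
the class series is CANONICAL. [folklore] -/
theorem mahler_unique {η : k} (hη : IsUnit (η - 1)) {s : PowerSeries k} (hs0 : constantCoeff s = 0)
    (hs1 : coeff 1 s = 1) {G G' : PowerSeries k} (h : η • G.subst s - G = η • G'.subst s - G') : G = G' := by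
  ext n
  exact mahler_congr_mod hη hs0 hs1 (N := n + 1) (fun m _ => by rw [h]) n (Nat.lt_succ_self n)

/-- **Existence for the Mahler equation**: for every `Φ` there is `G` with `η·G∘s − G = Φ` (`η − 1` a unit, `s ≡ T (mod T²)`);
the coefficients of `G` are produced by the triangular recursion `g_n = (η − 1)⁻¹·(φ_n − η·Σ_{d<n} g_d·[T^{n−d}](t^d))`.
[folklore] -/
theorem mahler_exists {η : k} (hη : IsUnit (η - 1)) {s : PowerSeries k} (hs0 : constantCoeff s = 0)
    (hs1 : coeff 1 s = 1) (Φ : PowerSeries k) : ∃ G : PowerSeries k, η • G.subst s - G = Φ := by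
  obtain ⟨t, rfl, ht⟩ := exists_eq_X_mul hs0 hs1
  obtain ⟨u, hu⟩ := hη
  -- the triangular recursion for the coefficients
  let step : ∀ n : ℕ, (∀ m, m < n → k) → k := fun n ih =>
    ↑u⁻¹ * (coeff n Φ - η * ∑ d ∈ (range n).attach, ih d.1 (mem_range.mp d.2) * coeff (n - d.1) (t ^ d.1))
  let g : ℕ → k := fun n => Nat.strongRec (motive := fun _ => k) step n
  have hg : ∀ n, g n = ↑u⁻¹ * (coeff n Φ - η * ∑ d ∈ range n, g d * coeff (n - d) (t ^ d)) := by
    intro n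
    have e : g n = step n (fun m _ => g m) := Nat.strongRec_eq step n
    rw [e]
    change ↑u⁻¹ * (coeff n Φ - η * ∑ d ∈ (range n).attach, g d.1 * coeff (n - d.1) (t ^ d.1)) = _
    rw [sum_attach (range n) (fun d => g d * coeff (n - d) (t ^ d))]
  refine ⟨PowerSeries.mk g, ?_⟩
  ext n
  rw [coeff_twistSubst η ht, ← hu, coeff_mk]
  simp only [coeff_mk]
  rw [hg n, ← mul_assoc, Units.mul_inv, one_mul, sub_add_cancel]

/-- **The Mahler equation has exactly one solution**: `∃! G, η·G∘s − G = Φ` (`η − 1` a unit, `s ≡ T (mod T²)`) —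
the twisted substitution operator `U_β` of the card is invertible on `k⟦T⟧`. [folklore] -/
theorem mahler_existsUnique {η : k} (hη : IsUnit (η - 1)) {s : PowerSeries k} (hs0 : constantCoeff s = 0)
    (hs1 : coeff 1 s = 1) (Φ : PowerSeries k) : ∃! G : PowerSeries k, η • G.subst s - G = Φ := by
  obtain ⟨G, hG⟩ := mahler_exists hη hs0 hs1 Φ
  exact ⟨G, hG, fun G' hG' => mahler_unique hη hs0 hs1 (hG'.trans hG.symm)⟩

/-- The card's characteristic-`2` form: `∃! G, G + η·G∘s = Φ` (there `−G = G`). [folklore] -/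
theorem mahler_existsUnique_charTwo [CharP k 2] {η : k} (hη : IsUnit (η - 1)) {s : PowerSeries k}
    (hs0 : constantCoeff s = 0) (hs1 : coeff 1 s = 1) (Φ : PowerSeries k) :
    ∃! G : PowerSeries k, G + η • G.subst s = Φ := by
  have e : ∀ G : PowerSeries k, G + η • G.subst s = η • G.subst s - G := fun G => by
    ext n
    rw [map_add, map_sub, CharTwo.sub_eq_add, add_comm]
  simp_rw [e]
  exact mahler_existsUnique hη hs0 hs1 Φ

end Summit.BirchSwinnertonDyer.BirchSwinnertonDyer.Theorems.SignedMuAtTwo.SmoothingCoboundary
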